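import Summits.QuantumFields.YangMills.Theorems.BalabanUVNodesN06Proj349AtPinsPhysRC
import Literature.MathematicalPhysics.QuantumFieldTheory.Balaban1983to89.B9Ineq349SiteThresholdRateNamed
import Literature.MathematicalPhysics.QuantumFieldTheory.Balaban1983to89.B9Thm313WholeDvHolderAtPinsGraded
import Literature.MathematicalPhysics.QuantumFieldTheory.Balaban1983to89.B9RowSum261DefiniteFaces
import Literature.MathematicalPhysics.QuantumFieldTheory.Balaban1983to89.B9WalkLettersCoordsS
import Literature.MathematicalPhysics.QuantumFieldTheory.Balaban1983to89.B9SmoothHolderClassPProducers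
import Literature.MathematicalPhysics.QuantumFieldTheory.Balaban1983to89.B9Eq340TaxiContourLocalityY

/-!
# BalabanUVNodes ∕ N06 ([B9], `Dag.B9_main`) — THE NUMERIC SIDE CONDITIONS OF THE STAGE-11 CERTIFICATE, EDITION 97 «UX», ARE JOINTLY SATISFIABLE — witness N (edition 95) with
# edition 97's ONE numeric change: the displayed Hölder-profile letter `BhG` (and its sign `hBhG`) is GONE — dag-n06-l's `g0_layer_of_thm310_coreDir₃USP` (P-DISP 5) produces the
# G₀ layer at the CLOSED profile `BhC β = holderConst (exp261 geo q.δ₀ q.α) q.δ₀ q.α q.NH q.NF (const37 …) (q.Bl β) (q.Bt β)` — so the U8 sup-bound `hwBhG` reads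
# `∀ s ∈ (0,1), wX s · BhC s ≤ BHG` on the closed form

Track A of `YM-PLAN.md` (cell `pub-ymgap`, HUMAN RULING D-0062), node **N06** = [Balaban1985BackgroundPropagators] Thms 3.1–3.15; seat `pub-ymgap-dag-n06-d` (gen 21).  A REFEREE AID
(A6 on the numerics), not a certificate edition; a fifteenth witness file.  WHAT.  Witness N's statement with the `BhG` variable and its sign conjunct removed and the `hwBhG` conjunct
restated VERBATIM as displayed by edition 97; values unchanged (at the witness `q.NH = q.NF = 0`, `q.Bl = q.Bt = 0`, so `BhC s = 2·0·0·c₁ + (0·0 + 0·0·C·c₁) = 0` and `BHG := 0`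
still works: `rw [pp.NH = 0, pp.NF = 0]; simp [holderConst]`).  Edition 97's other display changes (`hG0P` derived; `hLL2` assembled, `hrgdDs hc1L2 hrgdDd` displayed) carry no numeric.
HONEST FRAMING.  Arithmetic only; says nothing about the inhabitation of the displayed SCHEMAS at these numerics (the node's content); COUNT-NEUTRAL; N06 NOT discharged; K1⁹ NOT
closed.  One finite 𝕋⁴ programme at fixed `ε` — NOT continuum, NOT OS, NOT the mass gap ∕ Clay; no summit statement is proved here.  0 `def`, 0 `sorry`.
-/

noncomputable section

namespace Summit.QuantumFields.YangMills.BalabanUVNodes.N06NumericsWitnessO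

open Literature.MathematicalPhysics.QuantumFieldTheory.Balaban1983to89
open Literature.MathematicalPhysics.QuantumFieldTheory.Balaban1983to89.B9RWSumsDefinitePins (PinPrims)
open Literature.MathematicalPhysics.QuantumFieldTheory.Balaban1983to89.B9RWSumsDefinitePinsPair (PairPrims)
open Literature.MathematicalPhysics.QuantumFieldTheory.Balaban1983to89.B9RWSumsDefinitePinsPairM (MixedPrims)
open Literature.MathematicalPhysics.QuantumFieldTheory.Balaban1983to89.B9GeoNbrCountKLevelV1 (nbrM₀Y nbrCountY)
open Literature.MathematicalPhysics.QuantumFieldTheory.Balaban1983to89.B9PinMembersKLevelV1 (MemberY)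
open scoped Matrix.Norms.L2Operator
open Literature.MathematicalPhysics.QuantumFieldTheory.Balaban1983to89.B9PinMembersKLevelV1 (geo9Y)
open Literature.MathematicalPhysics.QuantumFieldTheory.Balaban1983to89.B9CoReadingCoordsTranspose (trBasis)
open Literature.MathematicalPhysics.QuantumFieldTheory.Balaban1983to89.B9Thm39ReadingCoords (cR39 coordBound39 basisBound39)
open Literature.MathematicalPhysics.QuantumFieldTheory.Balaban1983to89.B9Eq340TaxiContourLocalityY (rLB rLB_nonneg)
open Literature.MathematicalPhysics.QuantumFieldTheory.Balaban1983to89.B9Thm39ReadingAtLetters (basis39 κ39)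
open Literature.MathematicalPhysics.QuantumFieldTheory.Balaban1983to89.B9MultiscaleSmoothPartitionYNear (rNear)
open Literature.MathematicalPhysics.QuantumFieldTheory.Balaban1983to89.B9MultiscaleSmoothPartitionYLip (CLip)
open Literature.MathematicalPhysics.QuantumFieldTheory.Balaban1983to89.B9Thm313WholeDvHolderAtPinsGraded (thetaL CJG)
open Literature.MathematicalPhysics.QuantumFieldTheory.Balaban1983to89.B9RowSum261DefiniteFaces (rowConst261)
open Literature.MathematicalPhysics.QuantumFieldTheory.Balaban1983to89.B9WalkLettersCoordsS (nearBlkCntY)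
open Literature.MathematicalPhysics.QuantumFieldTheory.Balaban1983to89.B9Ineq349SiteThresholdRateNamed (cg349)
open Literature.MathematicalPhysics.QuantumFieldTheory.Balaban1983to89.B9SmoothHolderClassPProducers (CTel)

set_option maxHeartbeats 800000 in set_option synthInstance.maxSize 2048 in set_option maxRecDepth 8192 in
/-- ★ **THE PURE-NUMERIC DISPLAY OF EDITION 97 «UX» IS JOINTLY SATISFIABLE** — witness N's system with the letter `BhG` gone and `hwBhG` on the closed Hölder profile of the G₀ layer, for any `c > 0`.
[cite: Balaban1985BackgroundPropagators, Thm 3.3 (3.43)–(3.45) pp.397–398, Cor. 3.6 p.408, Thm 3.12 p.423 + (3.130) p.421 («with different constants»); Balaban1984PropagatorsII, (2.60)–(2.61) p.234, bookkeeping] -/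
theorem numerics_inhabited_ed97 (N d ℓ : ℕ) (hd : 1 ≤ d + 1) (hL : Odd (ℓ + 1) ∧ 1 < ℓ + 1) (b₀ b₁ : ℝ) :
    ∃ Mstar : ℕ, ∀ [∀ x : MemberY d ℓ hd hL b₀ b₁ Mstar, Fintype (geo9Y x).Site], ∀ δ₄ : ℝ, 0 < δ₄ → ∀ MMx aMx BMx δMx W : ℝ, 0 < MMx → 0 < aMx → 0 < BMx → 0 < δMx → 0 ≤ W →
      ∀ MRc aRc BRc δRc : ℝ, 0 < MRc → 0 < aRc → 0 < BRc → 0 < δRc → ∀ cJ : ℝ, 0 ≤ cJ → ∀ (Kc₀ : ℝ) (θW : ℝ → ℝ), 0 ≤ Kc₀ → (∀ C, 0 ≤ C → 0 ≤ θW C) → ∀ c : ℝ, 0 < c → ∃ (α' r39 δ39 B39 a39 M39 a311 M311 : ℝ) (p q : PinPrims) (p3 q3 : PairPrims) (pM qM : MixedPrims)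
      (δ12₀ δK12 σ12 ρ12 a12 M12 B12₃ δ12₃ ρ13 α12 θ₂ ρf12 : ℝ) (Bq12 : ℝ → ℝ) (t12 δT12 ρS σS B13₄ : ℝ)
      (Br13 BhD13 Bx13 Bd13 : ℝ → ℝ) (Bd2₁₃ : ℝ → ℝ → ℝ) (tJ δB rT δ₂ : ℝ) (Bx0 BdX : ℝ → ℝ) (a₀E δ₁E B₁E : ℝ) (w13 wX sch BZ : ℝ → ℝ) (ϑF δ45 : ℝ)
      (δ45Y : ℝ) (BiY : ℝ → ℝ) (αW σW δFW δ45W : ℝ) (B45W : ℝ → ℝ) (δhW : ℝ) (BhW : ℝ → ℝ) (CP s44 δ44 Bi44 : ℝ)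
      (B44G δ44G θK δKG B₀G δ₀G ρG BHG : ℝ) (θHG : ℝ → ℝ) (B43 δ43 ρrg : ℝ) (τS δP Bx13₀ M₂ MInv aInv aW B₀D : ℝ),
      (0 < α') ∧ (α' < 1) ∧ (0 < r39) ∧ (r39 ≤ δ39) ∧ (0 < B39) ∧ (0 < a39) ∧ (0 < M39) ∧ (0 < a311) ∧ (0 < M311) ∧
      p.OK ∧ q.OK ∧ p3.OK ∧ q3.OK ∧ pM.OK ∧ qM.OK ∧
      (nbrM₀Y d ℓ hd hL b₀ b₁ 2 ≤ Mstar) ∧ (nbrM₀Y d ℓ hd hL b₀ b₁ ((ℓ : ℝ) + 4) ≤ Mstar) ∧ (nbrM₀Y d ℓ hd hL b₀ b₁ 3 ≤ Mstar) ∧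
      (0 ≤ θ₂) ∧ (0 < ρf12) ∧ (ρf12 + σ12 ≤ (1 - α12) * ρ12) ∧ (ρf12 + 2 * σ12 + α12 * ρ12 ≤ ρ12) ∧ (∀ β, 0 ≤ Bq12 β) ∧ (0 ≤ B12₃) ∧
      (0 < σ12) ∧ (0 < ρ12) ∧ (ρ12 ≤ δ12₀) ∧ (ρ12 + 2 * σ12 ≤ δK12) ∧ (ρ12 + σ12 ≤ δ12₃) ∧ (0 < a12) ∧ (0 < M12) ∧ (0 < α12) ∧ (α12 ≤ 1 / 2) ∧ (δ12₃ < δ12₀) ∧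
      (δ12₀ ≤ (1 - 3 * q.αF) * ((1 - 2 * q.α) * q.δ₀)) ∧
      (0 ≤ t12) ∧ (0 < σS) ∧ (ρS ≤ δT12) ∧ (ρS + σS ≤ δ12₀) ∧ (δK12 + q.αF * ((1 - 2 * q.α) * q.δ₀) ≤ ρS) ∧
      (M311 ≤ M12) ∧ (a12 ≤ a311) ∧ (σS ≤ δK12) ∧ (0 < ρ13) ∧ (ρ13 + 5 * σ12 ≤ ρ12) ∧ (3 * σ12 < (1 - α12) * ρ13) ∧
      (0 ≤ B13₄) ∧ (∀ ε, 0 < ε → 0 ≤ Br13 ε) ∧ (∀ β, 0 ≤ β → β < 1 → 0 ≤ BhD13 β) ∧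
      (∀ β, 0 ≤ β → β < 1 → 0 ≤ Bx13 β) ∧ (∀ ε, 0 < ε → ε ≤ 1 → 0 ≤ Bd13 ε) ∧ (∀ ε β, 0 < ε → ε ≤ 1 → 0 ≤ β → β < 1 → 0 ≤ Bd2₁₃ ε β) ∧
      (0 ≤ cJ) ∧ (cJ * a12 ≤ 1) ∧ (2 * ((d : ℝ) + 1) * (((ℓ + 1 : ℕ) : ℝ)) ^ 3 * (N : ℝ) * (10 ^ 4 * ((d : ℝ) + 1) * cJ) * Real.exp (3 * δB) ≤ tJ) ∧
      (rT ≤ min ((1 - 2 * p.α) * p.δ₀) δ39 / 8) ∧ (rT ≤ δB) ∧ (0 ≤ δT12) ∧ (δT12 + 3 * σS + 3 * (q.αF * ((1 - 2 * q.α) * q.δ₀)) ≤ rT) ∧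
      (∀ β, 0 ≤ β → β < 1 → 0 ≤ Bx0 β) ∧ (∀ β, 0 ≤ β → β < 1 → 0 ≤ BdX β) ∧
      (0 < a₀E) ∧ (0 < δ₁E) ∧ (0 < B₁E) ∧ (rT ≤ δ₄) ∧ (rT ≤ δ₂) ∧ (δ12₃ ≤ (1 - 2 * q.αF) * rT - σS) ∧
      (MMx ≤ p.M₁) ∧ (p.a₁ ≤ aMx) ∧ (BMx ≤ pM.BM) ∧ (p.δ₀ ≤ δMx) ∧
      (MRc ≤ p.M₁) ∧ (p.a₁ ≤ aRc) ∧ (p.δ₀ ≤ δRc) ∧ (p.θ₀ * Real.exp ((3 / 4 + p.δ₀) * p.ρ) * BRc ≤ pM.θM) ∧ (W ≤ pM.NM) ∧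
      (3 ≤ p.ρ) ∧ (W ≤ p.Nc) ∧ (W ≤ p.N') ∧ ((((ℓ + 1 : ℕ) : ℝ)) ^ 2 ≤ p.Cℓ) ∧ (Kc₀ ≤ p.Kc) ∧ (θW p.Cℓ ≤ p.θ₀) ∧
      (∀ t, 0 ≤ w13 t) ∧ (∀ t, w13 t ≤ 1) ∧ (∀ t, 0 ≤ wX t) ∧ (∀ t, wX t ≤ 1) ∧ (∀ β', 0 ≤ β' → β' < 1 → 0 < sch β') ∧ (∀ β', 0 ≤ β' → β' < 1 → sch β' < 1) ∧
      (∀ β', 0 ≤ β' → β' < 1 → 0 < w13 (sch β')) ∧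
      (2 * (10 * (((ℓ + 1 : ℕ) : ℝ)) * a12) * (1 + 10 * (((ℓ + 1 : ℕ) : ℝ)) * a12) * Real.exp (4 * (10 * (((ℓ + 1 : ℕ) : ℝ)) * a12)) * (((ℓ + 1 : ℕ) : ℝ)) ≤ ϑF) ∧ (δ12₃ < δ45) ∧ (∀ β', 0 ≤ β' → β' < 1 → 0 ≤ BZ β') ∧
      -- editions 55, 57, 59, 53∕61 (in this order)
      (δ12₃ < δ45Y) ∧ (∀ β', 0 ≤ β' → β' < 1 → 0 ≤ BiY β') ∧
      (0 < αW) ∧ (αW < 1) ∧ (0 < σW) ∧ (0 < δFW) ∧ (δFW ≤ min ((1 - 2 * p.α) * p.δ₀) δ39 / 8) ∧ (0 ≤ δFW - αW * δFW - 2 * σW) ∧ (δ12₃ ≤ δFW - αW * δFW - 2 * σW) ∧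
      (∀ β', 0 ≤ β' → β' < 1 → 0 < wX (sch β')) ∧ (δFW - αW * δFW - 2 * σW ≤ δ45W) ∧ (∀ β', 0 ≤ β' → β' < 1 → 0 ≤ B45W β') ∧ (δFW - αW * δFW - σW ≤ δhW) ∧
      (∀ β', 0 ≤ β' → β' < 1 → 0 ≤ BhW β') ∧
      (((d + 1 : ℕ) : ℝ) * (coordBound39 (trBasis N) * basisBound39 (trBasis N) * nearBlkCntY d ℓ hd hL b₀ b₁ Mstar * ((max 1 (N : ℝ) * ((nbrCountY d ℓ hd hL b₀ b₁ 2 : ℝ) * p.C (B9RWSums347DefiniteFaces.exp261 (@geo9Y d ℓ hd hL b₀ b₁ Mstar) p.δ₀ p.α) * Real.exp (2 * ((1 - 2 * p.α) * p.δ₀)))) * (cR39 (basis39 (Matrix (Fin N) (Fin N) ℂ)) * Fintype.card (κ39 (Matrix (Fin N) (Fin N) ℂ)) * B39 * Real.exp (2 * δ39)) * (max 1 (N : ℝ) * ((nbrCountY d ℓ hd hL b₀ b₁ 2 : ℝ) * p.C (B9RWSums347DefiniteFaces.exp261 (@geo9Y d ℓ hd hL b₀ b₁ Mstar) p.δ₀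 p.α) * Real.exp (2 * ((1 - 2 * p.α) * p.δ₀)))) * cg349 d ℓ hd hL b₀ b₁ ((1 - 2 * p.α) * p.δ₀) δ39) * Real.exp (2 * (min ((1 - 2 * p.α) * p.δ₀) δ39 / 8))) ≤ CP) ∧
      (∀ β', 0 ≤ β' → β' < 1 → (cR39 (trBasis N))⁻¹ * ((wX (sch β'))⁻¹ * B45W β' + BhW β' * (CP * (((ℓ + 1 : ℕ) : ℝ))) * ((wX (sch β'))⁻¹ * ((((ℓ + 1 : ℕ) : ℝ)) * Real.exp ((δFW - αW * δFW - σW) * (rNear d ℓ + 1)))) * rowConst261 (@geo9Y d ℓ hd hL b₀ b₁ Mstar) σW * rowConst261 (@geo9Y d ℓ hd hL b₀ b₁ Mstar) σW) ≤ Bx13 β') ∧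
      (0 < s44) ∧ (s44 < 1) ∧ (0 < w13 s44) ∧ (δ12₃ < δ44) ∧ (0 ≤ Bi44) ∧
      (((d : ℝ) + 1) * ((1 + CLip d ℓ) * Bi44 * (CJG d ℓ (trBasis N) s44 (thetaL d ℓ ϑF) (w13 s44) (δ12₃ + 1 + 1 / 2 * (δ44 - δ12₃)) * (((ℓ + 1 : ℕ) : ℝ))) * rowConst261 (@geo9Y d ℓ hd hL b₀ b₁ Mstar) 1) ≤ B12₃) ∧
      (((d : ℝ) + 1) * (1 * (((d : ℝ) + 1) * ((1 + CLip d ℓ) * Bi44 * (CJG d ℓ (trBasis N) s44 (thetaL d ℓ ϑF) (w13 s44) (δ12₃ + 1 + 1 / 2 * (δ44 - δ12₃)) * (((ℓ + 1 : ℕ) : ℝ))) * rowConst261 (@geo9Y d ℓ hd hL b₀ b₁ Mstar) 1)) * rowConst261 (@geo9Y d ℓ hd hL b₀ b₁ Mstar) 1) ≤ B12₃) ∧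
      -- editions 65, 67′ (in this order)
      (0 < wX s44) ∧ (0 ≤ B44G) ∧ (δFW - αW * δFW - 2 * σW ≤ δ44G) ∧
      ((cR39 (trBasis N))⁻¹ * ((wX s44)⁻¹ * B44G + (((d + 1 : ℕ) : ℝ) * p.C (B9RWSums347DefiniteFaces.exp261 (@geo9Y d ℓ hd hL b₀ b₁ Mstar) p.δ₀ p.α)) * (CP * (((ℓ + 1 : ℕ) : ℝ))) * ((wX s44)⁻¹ * ((((ℓ + 1 : ℕ) : ℝ)) * Real.exp ((δFW - αW * δFW - σW) * (rNear d ℓ + 1)))) * rowConst261 (@geo9Y d ℓ hd hL b₀ b₁ Mstar) σW * rowConst261 (@geo9Y d ℓ hd hL b₀ b₁ Mstar) σW) ≤ B12₃) ∧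
      (0 ≤ θK) ∧ (∀ s, 0 < s → s < 1 → 0 ≤ θHG s) ∧ (0 ≤ B₀G) ∧ (0 ≤ BHG) ∧ (0 ≤ ρG) ∧ (ρG ≤ δ₀G) ∧ (ρG + σW ≤ δKG) ∧
      (θK * rowConst261 (@geo9Y d ℓ hd hL b₀ b₁ Mstar) σW < 1) ∧ (∀ s, 0 < s → s < 1 → wX s * B9RWSums343Holder.holderConst (B9RWSums347DefiniteFaces.exp261 (@geo9Y d ℓ hd hL b₀ b₁ Mstar) q.δ₀ q.α) q.δ₀ q.α q.NH q.NF (B9Thm37Whole.const37 (B9RWSums347DefiniteFaces.exp261 (@geo9Y d ℓ hd hL b₀ b₁ Mstar) q.δ₀ q.α) q.δ₀ q.α q.ρ q.B₀ q.Nc q.N' q.Cℓ q.Kc) (q.Bl s) (q.Bt s) ≤ BHG) ∧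
      ((((ℓ + 1 : ℕ) : ℝ)) * Real.exp (ρG * (rNear d ℓ + 1)) * (B₀G * (1 - θK * rowConst261 (@geo9Y d ℓ hd hL b₀ b₁ Mstar) σW)⁻¹ + BHG) ≤ B12₃) ∧ (δ12₃ ≤ ρG) ∧
      (0 ≤ B43) ∧ (0 ≤ ρrg) ∧ (ρrg + σW + αW * δFW ≤ δFW) ∧ (ρrg + σW ≤ δ43) ∧ (δ12₃ ≤ ρrg) ∧
      (B43 * (cR39 (trBasis N))⁻¹ * rowConst261 (@geo9Y d ℓ hd hL b₀ b₁ Mstar) σW + CTel d ℓ (trBasis N) ρrg (CP * (((ℓ + 1 : ℕ) : ℝ)) * ((((d + 1 : ℕ) : ℝ) * p.C (B9RWSums347DefiniteFaces.exp261 (@geo9Y d ℓ hd hL b₀ b₁ Mstar) p.δ₀ p.α)) * (cR39 (trBasis N))⁻¹ * rowConst261 (@geo9Y d ℓ hd hL b₀ b₁ Mstar) σW) * rowConst261 (@geo9Y d ℓ hd hL b₀ b₁ Mstar) σW) (CP * (((ℓ + 1 : ℕ) : ℝ)) * ((((d + 1 : ℕ) : ℝ) * p.C (B9RWSums347DefiniteFaces.exp261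 (@geo9Y d ℓ hd hL b₀ b₁ Mstar) p.δ₀ p.α)) * (cR39 (trBasis N))⁻¹ * rowConst261 (@geo9Y d ℓ hd hL b₀ b₁ Mstar) σW) * rowConst261 (@geo9Y d ℓ hd hL b₀ b₁ Mstar) σW) ≤ B12₃) ∧
      -- editions 75∕76 (U8 state-layer budget + the (α3) thresholds; `hbud43T`, `hρS₃`, `hθV13` are gone with their binders)
      (0 < τS) ∧ (0 ≤ Bx13₀) ∧ (∀ s', 0 < s' → s' < 1 → wX s' * Bx13 s' ≤ Bx13₀) ∧ (ρ12 + 2 * σ12 ≤ δP) ∧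
      (δK12 + 3 * σS + 4 * τS ≤ (1 - 2 * p.α) * p.δ₀) ∧ (δK12 + 3 * σS + 4 * τS ≤ min ((1 - 2 * p.α) * p.δ₀) δ39 / 8) ∧ (δK12 + 3 * σS + 4 * τS ≤ δ₂) ∧
      (δK12 + 3 * σS + 5 * τS ≤ δ44G) ∧ (δK12 + 3 * σS + 4 * τS ≤ δB) ∧ (δK12 + 2 * σS + τS ≤ δ43) ∧ (δK12 + τS + σS ≤ δT12) ∧ (δK12 + τS + σS ≤ δ12₃) ∧
      (δK12 + τS + σS ≤ δP) ∧ (δP + 2 * τS ≤ δ12₀) ∧ (δP + σS + 2 * τS ≤ δ12₃) ∧ (δP + τS ≤ δ₀G) ∧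
      (0 ≤ M₂) ∧ (0 < MInv) ∧ (0 < aInv) ∧ (0 < aW) ∧ (2 * ((d : ℝ) + 1) < MInv) ∧ (rLB d ℓ + 1 < MInv) ∧
      -- edition 91 «UR»: the (3.43) input budget of dag-n06-c's `h43Gp_of_thm37PrintedSN` and the two transfer numerics (any class constant `c > 0`)
      (0 ≤ B₀D) ∧ (∀ s : ℝ, 0 < s → s < 1 → w13 s * ((((d + 1 : ℕ) : ℝ)) * (B9RWSums343Holder.holderConst (B9RWSums347DefiniteFaces.exp261 (@geo9Y d ℓ hd hL b₀ b₁ Mstar) p.δ₀ p.α) p.δ₀ p.α p.NH p.N' (p.C (B9RWSums347DefiniteFaces.exp261 (@geo9Y d ℓ hd hL b₀ b₁ Mstar) p.δ₀ p.α)) (p.Bl s) (p.Bt s) + 2 * B9Thm39ReadingCoords.coordBound39 (trBasis N) * B9Thm39ReadingCoords.basisBound39 (trBasis N) * ((ℓ : ℝ) + 1) * Real.exp (((1 - 2 * p.α) * p.δ₀) * (((d : ℝ) + 1) * (((ℓ : ℝ) + 1) + 1) + 2)) * ((((d + 1 : ℕ) : ℝ)) ^ 2 * (2 * (10 * ((ℓ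 + 1 : ℕ) : ℝ) * (p.a₁ / c)) * (1 + 10 * ((ℓ + 1 : ℕ) : ℝ) * (p.a₁ / c)) * Real.exp (4 * (10 * ((ℓ + 1 : ℕ) : ℝ) * (p.a₁ / c)))) * ((ℓ + 1 : ℕ) : ℝ) ^ 6) * (p.C (B9RWSums347DefiniteFaces.exp261 (@geo9Y d ℓ hd hL b₀ b₁ Mstar) p.δ₀ p.α)) + B9Thm39ReadingCoords.coordBound39 (trBasis N) * B9Thm39ReadingCoords.basisBound39 (trBasis N) * (p.C (B9RWSums347DefiniteFaces.exp261 (@geo9Y d ℓ hd hL b₀ b₁ Mstar) p.δ₀ p.α)) + (p.C (B9RWSums347DefiniteFaces.exp261 (@geo9Y d ℓ hd hL b₀ b₁ Mstar) p.δ₀ p.α)))) ≤ B₀D) ∧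
      ((((ℓ + 1 : ℕ) : ℝ)) * ((((d + 1 : ℕ) : ℝ)) * (p.C (B9RWSums347DefiniteFaces.exp261 (@geo9Y d ℓ hd hL b₀ b₁ Mstar) p.δ₀ p.α)) + B₀D) * Real.exp (((1 - 2 * p.α) * p.δ₀) * (rNear d ℓ + 1)) ≤ B43) ∧ (δ43 ≤ ((1 - 2 * p.α) * p.δ₀)) ∧
      -- edition 93 «UT»: the two transfer numerics of the `hpDGW` fold (dag-n06-c's a₀-uniform closed (3.44)-profile ≤ `BhW`, rate)
      (∀ β', 0 ≤ β' → β' < 1 → ((B9RWSums343Holder.holderConst (B9RWSums347DefiniteFaces.exp261 (@geo9Y d ℓ hd hL b₀ b₁ Mstar) p.δ₀ p.α) p.δ₀ p.α p.NH p.N' (p.C (B9RWSums347DefiniteFaces.exp261 (@geo9Y d ℓ hd hL b₀ b₁ Mstar) p.δ₀ p.α)) (p.Bl β') (p.Bt β') + 2 * B9Thm39ReadingCoords.coordBound39 (trBasis N) * B9Thm39ReadingCoords.basisBound39 (trBasis N) * ((ℓ : ℝ) + 1) * Real.exp (((1 - 2 * p.α) * p.δ₀) * (((d : ℝ) + 1)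 * (((ℓ : ℝ) + 1) + 1) + 2)) * ((((d + 1 : ℕ) : ℝ)) ^ 2 * (2 * (10 * ((ℓ + 1 : ℕ) : ℝ) * (p.a₁ / c)) * (1 + 10 * ((ℓ + 1 : ℕ) : ℝ) * (p.a₁ / c)) * Real.exp (4 * (10 * ((ℓ + 1 : ℕ) : ℝ) * (p.a₁ / c)))) * ((ℓ + 1 : ℕ) : ℝ) ^ 6) * (p.C (B9RWSums347DefiniteFaces.exp261 (@geo9Y d ℓ hd hL b₀ b₁ Mstar) p.δ₀ p.α)) + B9Thm39ReadingCoords.coordBound39 (trBasis N) * B9Thm39ReadingCoords.basisBound39 (trBasis N) * (p.C (B9RWSums347DefiniteFaces.exp261 (@geo9Y d ℓ hd hL b₀ b₁ Mstar) p.δ₀ p.α)) + (p.C (B9RWSums347DefiniteFaces.exp261 (@geo9Y d ℓ hd hL b₀ b₁ Mstar) p.δ₀ p.α))) + (p.C (B9RWSums347DefiniteFaces.exp261 (@geo9Y d ℓ hd hL b₀ b₁ Mstar) p.δ₀ p.α)) + B9Thm39ReadingCoords.coordBound39 (trBasis N) * B9Thm39ReadingCoords.basisBound39 (trBasis N) *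 (p.C (B9RWSums347DefiniteFaces.exp261 (@geo9Y d ℓ hd hL b₀ b₁ Mstar) p.δ₀ p.α))) ≤ BhW β') ∧ (δhW ≤ ((1 - 2 * p.α) * p.δ₀)) ∧
      -- edition 95 «UV» (in this order): `hα3`, `hschβ`, and the ten transfer numerics of the folds of `h44m h45X h45Y` (dag-n06-c `h44m_h45X_h45Y_of_local3107`, q-side) and `h44G hp45W` (`h44G_hp45W_of_thm37PrintedSN`, p-side)
      (3 * p.α ≤ (1 - p.αF) * (1 - 2 * p.α)) ∧ (∀ β', 0 ≤ β' → β' < 1 → β' < sch β') ∧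
      ((((ℓ + 1 : ℕ) : ℝ)) * B9RWSums344Input.inputConst44 (B9RWSums347DefiniteFaces.exp261 (@geo9Y d ℓ hd hL b₀ b₁ Mstar) q.δ₀ q.α) q.δ₀ q.α q.NI q.NF (B9Thm37Whole.const37 (B9RWSums347DefiniteFaces.exp261 (@geo9Y d ℓ hd hL b₀ b₁ Mstar) q.δ₀ q.α) q.δ₀ q.α q.ρ q.B₀ q.Nc q.N' q.Cℓ q.Kc) (((ℓ + 1 : ℕ) : ℝ)) (q.BI s44) (q.θI s44) ≤ Bi44) ∧ (δ44 ≤ ((1 - q.αF) * ((1 - 2 * q.α) * q.δ₀) - q.α * q.δ₀)) ∧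
      (∀ β', 0 ≤ β' → β' < 1 → (((ℓ + 1 : ℕ) : ℝ)) * B9RWSums344Input.inputConst45 (B9RWSums347DefiniteFaces.exp261 (@geo9Y d ℓ hd hL b₀ b₁ Mstar) q.δ₀ q.α) q.δ₀ q.α q.NI q.NF (((ℓ + 1 : ℕ) : ℝ)) (B9RWSums343Holder.holderConst (B9RWSums347DefiniteFaces.exp261 (@geo9Y d ℓ hd hL b₀ b₁ Mstar) q.δ₀ q.α) q.δ₀ q.α q.NH q.NF (B9Thm37Whole.const37 (B9RWSums347DefiniteFaces.exp261 (@geo9Y d ℓ hd hL b₀ b₁ Mstar) q.δ₀ q.α) q.δ₀ q.α q.ρ q.B₀ q.Nc q.N' q.Cℓ q.Kc) (q.Bl β') (q.Bt β')) (q.BI2 (sch β' - β') β') (q.θI (sch β')) ≤ BZ β') ∧ (δ45 ≤ ((1 - q.αF) * ((1 - 2 * q.α) * q.δ₀) - q.α * q.δ₀)) ∧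
      (∀ β', 0 ≤ β' → β' < 1 → (((ℓ + 1 : ℕ) : ℝ)) * B9RWSums344Input.inputConst45 (B9RWSums347DefiniteFaces.exp261 (@geo9Y d ℓ hd hL b₀ b₁ Mstar) q.δ₀ q.α) q.δ₀ q.α q.NI q.NF (((ℓ + 1 : ℕ) : ℝ)) (B9RWSums343Holder.holderConst (B9RWSums347DefiniteFaces.exp261 (@geo9Y d ℓ hd hL b₀ b₁ Mstar) q.δ₀ q.α) q.δ₀ q.α q.NH q.NF (B9Thm37Whole.const37 (B9RWSums347DefiniteFaces.exp261 (@geo9Y d ℓ hd hL b₀ b₁ Mstar) q.δ₀ q.α) q.δ₀ q.α q.ρ q.B₀ q.Nc q.N' q.Cℓ q.Kc) (q.Bl β') (q.Bt β')) (q.BI2 (sch β' - β') β') (q.θI (sch β')) ≤ BiY β') ∧ (δ45Y ≤ ((1 - q.αF) * ((1 - 2 * q.α) * q.δ₀) - q.α * q.δ₀)) ∧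
      ((((ℓ + 1 : ℕ) : ℝ)) * ((((d + 1 : ℕ) : ℝ)) * ((1 + CLip d ℓ) * B9RWSums344Input.inputConst44 (B9RWSums347DefiniteFaces.exp261 (@geo9Y d ℓ hd hL b₀ b₁ Mstar) p.δ₀ p.α) p.δ₀ p.α p.NI p.N' (p.C (B9RWSums347DefiniteFaces.exp261 (@geo9Y d ℓ hd hL b₀ b₁ Mstar) p.δ₀ p.α)) (((ℓ + 1 : ℕ) : ℝ)) (p.BI s44) (p.θI s44) * ((((ℓ + 1 : ℕ) : ℝ)) * ((((ℓ + 1 : ℕ) : ℝ)) ^ 3 * (2 + 2 * coordBound39 (trBasis N) * basisBound39 (trBasis N) * (((ℓ + 1 : ℕ) : ℝ)) ^ 2)) * Real.exp ((1 - p.αF) * ((1 - 2 * p.α) * p.δ₀) * (2 * (rNear d ℓ + 1) + (((d : ℝ) + 1) * (((ℓ : ℝ) + 1) + 1) + 2)))) * B6.c1 (B9RWSums347DefiniteFaces.exp261 (@geo9Y d ℓ hd hL b₀ b₁ Mstar) p.δ₀ p.α) p.δ₀ p.α)) ≤ B44G) ∧ (δ44G ≤ ((1 - p.αF) * ((1 -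 2 * p.α) * p.δ₀) - 3 * (p.α * p.δ₀))) ∧
      (∀ β', 0 ≤ β' → β' < 1 → (((d + 1 : ℕ) : ℝ)) * ((((((ℓ + 1 : ℕ) : ℝ)) * ((1 + CLip d ℓ) * B9RWSums344Input.inputConst45 (B9RWSums347DefiniteFaces.exp261 (@geo9Y d ℓ hd hL b₀ b₁ Mstar) p.δ₀ p.α) p.δ₀ p.α p.NI p.N' (((ℓ + 1 : ℕ) : ℝ)) (B9RWSums343Holder.holderConst (B9RWSums347DefiniteFaces.exp261 (@geo9Y d ℓ hd hL b₀ b₁ Mstar) p.δ₀ p.α) p.δ₀ p.α p.NH p.N' (p.C (B9RWSums347DefiniteFaces.exp261 (@geo9Y d ℓ hd hL b₀ b₁ Mstar) p.δ₀ p.α)) (p.Bl β') (p.Bt β')) (p.BI2 (sch β' - β') β') (p.θI (sch β')) * ((((ℓ + 1 : ℕ) : ℝ)) * ((((ℓ + 1 : ℕ) : ℝ)) ^ 3 * (2 + 2 * coordBound39 (trBasis N) * basisBound39 (trBasis N) * (((ℓ + 1 : ℕ) : ℝ)) ^ 2)) * Real.exp ((1 - p.αF) * ((1 - 2 * p.α)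 * p.δ₀) * (2 * (rNear d ℓ + 1) + (((d : ℝ) + 1) * (((ℓ : ℝ) + 1) + 1) + 2)))) * B6.c1 (B9RWSums347DefiniteFaces.exp261 (@geo9Y d ℓ hd hL b₀ b₁ Mstar) p.δ₀ p.α) p.δ₀ p.α)) + 2 * coordBound39 (trBasis N) * basisBound39 (trBasis N) * ((ℓ : ℝ) + 1) * Real.exp (((1 - p.αF) * ((1 - 2 * p.α) * p.δ₀) - 3 * (p.α * p.δ₀)) * (((d : ℝ) + 1) * (((ℓ : ℝ) + 1) + 1) + 2)) * ((((d + 1 : ℕ) : ℝ)) ^ 2 * (2 * (10 * (((ℓ + 1 : ℕ) : ℝ)) * (p.a₁ / c)) * (1 + 10 * (((ℓ + 1 : ℕ) : ℝ)) * (p.a₁ / c)) * Real.exp (4 * (10 * (((ℓ + 1 : ℕ) : ℝ)) * (p.a₁ / c)))) * (((ℓ + 1 : ℕ) : ℝ)) ^ 6) * ((((ℓ + 1 : ℕ) : ℝ)) * ((1 + CLip d ℓ) * B9RWSums344Input.inputConst44 (B9RWSums347DefiniteFaces.exp261 (@geo9Y d ℓ hd hL b₀ b₁ Mstar) p.δ₀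 p.α) p.δ₀ p.α p.NI p.N' (p.C (B9RWSums347DefiniteFaces.exp261 (@geo9Y d ℓ hd hL b₀ b₁ Mstar) p.δ₀ p.α)) (((ℓ + 1 : ℕ) : ℝ)) (p.BI (sch β')) (p.θI (sch β')) * ((((ℓ + 1 : ℕ) : ℝ)) * ((((ℓ + 1 : ℕ) : ℝ)) ^ 3 * (2 + 2 * coordBound39 (trBasis N) * basisBound39 (trBasis N) * (((ℓ + 1 : ℕ) : ℝ)) ^ 2)) * Real.exp ((1 - p.αF) * ((1 - 2 * p.α) * p.δ₀) * (2 * (rNear d ℓ + 1) + (((d : ℝ) + 1) * (((ℓ : ℝ) + 1) + 1) + 2)))) * B6.c1 (B9RWSums347DefiniteFaces.exp261 (@geo9Y d ℓ hd hL b₀ b₁ Mstar) p.δ₀ p.α) p.δ₀ p.α)) + coordBound39 (trBasis N) * basisBound39 (trBasis N) * ((((ℓ + 1 : ℕ) : ℝ)) * ((1 + CLip d ℓ) * B9RWSums344Input.inputConst44 (B9RWSums347DefiniteFaces.exp261 (@geo9Y d ℓ hd hL b₀ b₁ Mstar) p.δ₀ p.α) p.δ₀ p.α p.NI p.N' (p.C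 (B9RWSums347DefiniteFaces.exp261 (@geo9Y d ℓ hd hL b₀ b₁ Mstar) p.δ₀ p.α)) (((ℓ + 1 : ℕ) : ℝ)) (p.BI (sch β')) (p.θI (sch β')) * ((((ℓ + 1 : ℕ) : ℝ)) * ((((ℓ + 1 : ℕ) : ℝ)) ^ 3 * (2 + 2 * coordBound39 (trBasis N) * basisBound39 (trBasis N) * (((ℓ + 1 : ℕ) : ℝ)) ^ 2)) * Real.exp ((1 - p.αF) * ((1 - 2 * p.α) * p.δ₀) * (2 * (rNear d ℓ + 1) + (((d : ℝ) + 1) * (((ℓ : ℝ) + 1) + 1) + 2)))) * B6.c1 (B9RWSums347DefiniteFaces.exp261 (@geo9Y d ℓ hd hL b₀ b₁ Mstar) p.δ₀ p.α) p.δ₀ p.α)) + ((((ℓ + 1 : ℕ) : ℝ)) * ((1 + CLip d ℓ) * B9RWSums344Input.inputConst44 (B9RWSums347DefiniteFaces.exp261 (@geo9Y d ℓ hd hL b₀ b₁ Mstar) p.δ₀ p.α) p.δ₀ p.α p.NI p.N' (p.C (B9RWSums347DefiniteFaces.exp261 (@geo9Y d ℓ hd hL b₀ b₁ Mstar) p.δ₀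 p.α)) (((ℓ + 1 : ℕ) : ℝ)) (p.BI (sch β')) (p.θI (sch β')) * ((((ℓ + 1 : ℕ) : ℝ)) * ((((ℓ + 1 : ℕ) : ℝ)) ^ 3 * (2 + 2 * coordBound39 (trBasis N) * basisBound39 (trBasis N) * (((ℓ + 1 : ℕ) : ℝ)) ^ 2)) * Real.exp ((1 - p.αF) * ((1 - 2 * p.α) * p.δ₀) * (2 * (rNear d ℓ + 1) + (((d : ℝ) + 1) * (((ℓ : ℝ) + 1) + 1) + 2)))) * B6.c1 (B9RWSums347DefiniteFaces.exp261 (@geo9Y d ℓ hd hL b₀ b₁ Mstar) p.δ₀ p.α) p.δ₀ p.α))) + ((((ℓ + 1 : ℕ) : ℝ)) * ((1 + CLip d ℓ) * B9RWSums344Input.inputConst44 (B9RWSums347DefiniteFaces.exp261 (@geo9Y d ℓ hd hL b₀ b₁ Mstar) p.δ₀ p.α) p.δ₀ p.α p.NI p.N' (p.C (B9RWSums347DefiniteFaces.exp261 (@geo9Y d ℓ hd hL b₀ b₁ Mstar) p.δ₀ p.α)) (((ℓ + 1 : ℕ) : ℝ)) (p.BI (sch β')) (p.θI (sch β')) * ((((ℓ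 + 1 : ℕ) : ℝ)) * ((((ℓ + 1 : ℕ) : ℝ)) ^ 3 * (2 + 2 * coordBound39 (trBasis N) * basisBound39 (trBasis N) * (((ℓ + 1 : ℕ) : ℝ)) ^ 2)) * Real.exp ((1 - p.αF) * ((1 - 2 * p.α) * p.δ₀) * (2 * (rNear d ℓ + 1) + (((d : ℝ) + 1) * (((ℓ : ℝ) + 1) + 1) + 2)))) * B6.c1 (B9RWSums347DefiniteFaces.exp261 (@geo9Y d ℓ hd hL b₀ b₁ Mstar) p.δ₀ p.α) p.δ₀ p.α)) + coordBound39 (trBasis N) * basisBound39 (trBasis N) * ((((ℓ + 1 : ℕ) : ℝ)) * ((1 + CLip d ℓ) * B9RWSums344Input.inputConst44 (B9RWSums347DefiniteFaces.exp261 (@geo9Y d ℓ hd hL b₀ b₁ Mstar) p.δ₀ p.α) p.δ₀ p.α p.NI p.N' (p.C (B9RWSums347DefiniteFaces.exp261 (@geo9Y d ℓ hd hL b₀ b₁ Mstar) p.δ₀ p.α)) (((ℓ + 1 : ℕ) : ℝ)) (p.BI (sch β')) (p.θI (sch β')) * ((((ℓ + 1 : ℕ) : ℝ)) * ((((ℓ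 + 1 : ℕ) : ℝ)) ^ 3 * (2 + 2 * coordBound39 (trBasis N) * basisBound39 (trBasis N) * (((ℓ + 1 : ℕ) : ℝ)) ^ 2)) * Real.exp ((1 - p.αF) * ((1 - 2 * p.α) * p.δ₀) * (2 * (rNear d ℓ + 1) + (((d : ℝ) + 1) * (((ℓ : ℝ) + 1) + 1) + 2)))) * B6.c1 (B9RWSums347DefiniteFaces.exp261 (@geo9Y d ℓ hd hL b₀ b₁ Mstar) p.δ₀ p.α) p.δ₀ p.α))) ≤ B45W β') ∧ (δ45W ≤ ((1 - p.αF) * ((1 - 2 * p.α) * p.δ₀) - 3 * (p.α * p.δ₀))) := by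
  -- as `numerics_inhabited_ed47` (+ `w13 wX sch := 1/2`, `BZ := 0`, `ϑF :=` budget, `δ45 := δ12₃ + 1`), i.e. `numerics_inhabited_ed43` with `p.ρ := 3`, `p.Nc := p.N' := W`, `p.Cℓ := L²`, `p.Kc := Kc₀`, `p.θ₀ := θW (L²)`, `pM.θM := θW(L²)·e^{(3/4+s)·3}·BRc`, `M⋆ ≥ nbrM₀Y 3`
  refine ⟨max (max (nbrM₀Y d ℓ hd hL b₀ b₁ 2) (nbrM₀Y d ℓ hd hL b₀ b₁ ((ℓ : ℝ) + 4))) (nbrM₀Y d ℓ hd hL b₀ b₁ 3),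
    fun δ₄ hδ₄ MMx aMx BMx δMx W hMMx haMx hBMx hδMx hW MRc aRc BRc δRc hMRc haRc hBRc hδRc cJ hcJ Kc₀ θW hKc₀ hθW c hc => ?_⟩
  set s : ℝ := min 1 (min δ₄ (min δMx δRc)) with hsdef
  have hs : 0 < s := lt_min one_pos (lt_min hδ₄ (lt_min hδMx hδRc))
  have hs4 : s ≤ δ₄ := (min_le_right _ _).trans (min_le_left _ _)
  have hsM : s ≤ δMx := (min_le_right _ _).trans ((min_le_right _ _).trans (min_le_left _ _))
  have hsR : s ≤ δRc := (min_le_right _ _).trans ((min_le_right _ _).trans (min_le_right _ _))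
  have hL2 : (1 : ℝ) ≤ (((ℓ + 1 : ℕ) : ℝ)) ^ 2 := one_le_pow₀ (by exact_mod_cast Nat.succ_le_succ (Nat.zero_le ℓ))
  let pp : PinPrims :=
    { α := 1 / 8, ρ := 3, Nc := W, N' := W, NF := 0, Cℓ := (((ℓ + 1 : ℕ) : ℝ)) ^ 2, Kc := Kc₀, θ₀ := θW ((((ℓ + 1 : ℕ) : ℝ)) ^ 2), B₀ := 1, δ₀ := s, a₁ := min 1 (min aMx aRc), M₁ := max 1 (max MMx MRc), αF := 1 / 1000,
      NH := 0, NL := 0, BL := 0, NI := 0, N2 := 0, B2 := 0, θ2 := 0, Bl := fun _ => 0, Bt := fun _ => 0, BI := fun _ => 0, θI := fun _ => 0,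
      BI2 := fun _ _ => 0 }
  have hpp : pp.OK :=
    { α_pos := by norm_num [pp], α_lt := by norm_num [pp], Nc_nn := hW, N'_nn := hW, NF_nn := le_rfl, one_le_Cℓ := hL2, Kc_nn := hKc₀,
      θ₀_nn := hθW _ (by positivity), B₀_pos := by norm_num [pp], δ₀_pos := hs, a₁_pos := lt_min one_pos (lt_min haMx haRc), M₁_pos := lt_of_lt_of_le one_pos (le_max_left _ _),
      αF_pos := by norm_num [pp], αF_lt := by norm_num [pp], NH_nn := le_rfl, NL_nn := le_rfl, BL_nn := le_rfl, NI_nn := le_rfl, N2_nn := le_rfl,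
      B2_nn := le_rfl, θ2_nn := le_rfl, Bl_nn := fun _ _ _ => le_rfl, Bt_nn := fun _ _ _ => le_rfl, BI_nn := fun _ _ _ => le_rfl,
      BI2_nn := fun _ _ _ _ _ _ => le_rfl, θI_nn := fun _ _ => le_rfl }
  have hα : pp.α = 1 / 8 := rfl
  have hδ : pp.δ₀ = s := rfl
  have hF : pp.αF = 1 / 1000 := rfl
  set CPw : ℝ := ((d + 1 : ℕ) : ℝ) * (coordBound39 (trBasis N) * basisBound39 (trBasis N) * nearBlkCntY d ℓ hd hL b₀ b₁ (max (max (nbrM₀Y d ℓ hd hL b₀ b₁ 2) (nbrM₀Y d ℓ hd hL b₀ b₁ ((ℓ : ℝ) + 4))) (nbrM₀Y d ℓ hd hL b₀ b₁ 3)) * ((max 1 (N : ℝ) * ((nbrCountY d ℓ hd hL b₀ b₁ 2 : ℝ) * pp.C (B9RWSums347DefiniteFaces.exp261 (@geo9Y d ℓ hd hL b₀ b₁ (max (max (nbrM₀Y d ℓ hd hL b₀ b₁ 2) (nbrM₀Y d ℓ hd hL b₀ b₁ ((ℓ : ℝ) + 4))) (nbrM₀Y d ℓ hd hL b₀ b₁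 3))) pp.δ₀ pp.α) * Real.exp (2 * ((1 - 2 * pp.α) * pp.δ₀)))) * (cR39 (basis39 (Matrix (Fin N) (Fin N) ℂ)) * Fintype.card (κ39 (Matrix (Fin N) (Fin N) ℂ)) * 1 * Real.exp (2 * s)) * (max 1 (N : ℝ) * ((nbrCountY d ℓ hd hL b₀ b₁ 2 : ℝ) * pp.C (B9RWSums347DefiniteFaces.exp261 (@geo9Y d ℓ hd hL b₀ b₁ (max (max (nbrM₀Y d ℓ hd hL b₀ b₁ 2) (nbrM₀Y d ℓ hd hL b₀ b₁ ((ℓ : ℝ) + 4))) (nbrM₀Y d ℓ hd hL b₀ b₁ 3))) pp.δ₀ pp.α) * Real.exp (2 * ((1 - 2 * pp.α) * pp.δ₀)))) * cg349 d ℓ hd hL b₀ b₁ ((1 - 2 * pp.α) * pp.δ₀) s) * Real.exp (2 * (min ((1 - 2 * pp.α) * pp.δ₀) s / 8))) with hCPw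
  let BIG0 : ℝ := ((((d + 1 : ℕ) : ℝ)) * (B9RWSums343Holder.holderConst (B9RWSums347DefiniteFaces.exp261 (@geo9Y d ℓ hd hL b₀ b₁ (max (max (nbrM₀Y d ℓ hd hL b₀ b₁ 2) (nbrM₀Y d ℓ hd hL b₀ b₁ ((ℓ : ℝ) + 4))) (nbrM₀Y d ℓ hd hL b₀ b₁ 3))) pp.δ₀ pp.α) pp.δ₀ pp.α pp.NH pp.N' (pp.C (B9RWSums347DefiniteFaces.exp261 (@geo9Y d ℓ hd hL b₀ b₁ (max (max (nbrM₀Y d ℓ hd hL b₀ b₁ 2) (nbrM₀Y d ℓ hd hL b₀ b₁ ((ℓ : ℝ) + 4))) (nbrM₀Y d ℓ hd hL b₀ b₁ 3))) pp.δ₀ pp.α)) (pp.Bl 0) (pp.Bt 0) + 2 * B9Thm39ReadingCoords.coordBound39 (trBasis N) * B9Thm39ReadingCoords.basisBound39 (trBasis N) * ((ℓ : ℝ) + 1) * Real.exp (((1 - 2 * pp.α) * pp.δ₀) * (((d : ℝ) + 1) * (((ℓ : ℝ) + 1) + 1) + 2)) * ((((d + 1 : ℕ) : ℝ)) ^ 2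 * (2 * (10 * ((ℓ + 1 : ℕ) : ℝ) * (pp.a₁ / c)) * (1 + 10 * ((ℓ + 1 : ℕ) : ℝ) * (pp.a₁ / c)) * Real.exp (4 * (10 * ((ℓ + 1 : ℕ) : ℝ) * (pp.a₁ / c)))) * ((ℓ + 1 : ℕ) : ℝ) ^ 6) * (pp.C (B9RWSums347DefiniteFaces.exp261 (@geo9Y d ℓ hd hL b₀ b₁ (max (max (nbrM₀Y d ℓ hd hL b₀ b₁ 2) (nbrM₀Y d ℓ hd hL b₀ b₁ ((ℓ : ℝ) + 4))) (nbrM₀Y d ℓ hd hL b₀ b₁ 3))) pp.δ₀ pp.α)) + B9Thm39ReadingCoords.coordBound39 (trBasis N) * B9Thm39ReadingCoords.basisBound39 (trBasis N) * (pp.C (B9RWSums347DefiniteFaces.exp261 (@geo9Y d ℓ hd hL b₀ b₁ (max (max (nbrM₀Y d ℓ hd hL b₀ b₁ 2) (nbrM₀Y d ℓ hd hL b₀ b₁ ((ℓ : ℝ) + 4))) (nbrM₀Y d ℓ hd hL b₀ b₁ 3))) pp.δ₀ pp.α)) + (pp.C (B9RWSums347DefiniteFaces.exp261 (@geo9Y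 d ℓ hd hL b₀ b₁ (max (max (nbrM₀Y d ℓ hd hL b₀ b₁ 2) (nbrM₀Y d ℓ hd hL b₀ b₁ ((ℓ : ℝ) + 4))) (nbrM₀Y d ℓ hd hL b₀ b₁ 3))) pp.δ₀ pp.α))))
  let B0D : ℝ := max 0 ((1 / 2 : ℝ) * BIG0)
  let K43 : ℝ := (((ℓ + 1 : ℕ) : ℝ)) * ((((d + 1 : ℕ) : ℝ)) * (pp.C (B9RWSums347DefiniteFaces.exp261 (@geo9Y d ℓ hd hL b₀ b₁ (max (max (nbrM₀Y d ℓ hd hL b₀ b₁ 2) (nbrM₀Y d ℓ hd hL b₀ b₁ ((ℓ : ℝ) + 4))) (nbrM₀Y d ℓ hd hL b₀ b₁ 3))) pp.δ₀ pp.α)) + B0D) * Real.exp (((1 - 2 * pp.α) * pp.δ₀) * (rNear d ℓ + 1))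
  let KW : ℝ := ((B9RWSums343Holder.holderConst (B9RWSums347DefiniteFaces.exp261 (@geo9Y d ℓ hd hL b₀ b₁ (max (max (nbrM₀Y d ℓ hd hL b₀ b₁ 2) (nbrM₀Y d ℓ hd hL b₀ b₁ ((ℓ : ℝ) + 4))) (nbrM₀Y d ℓ hd hL b₀ b₁ 3))) pp.δ₀ pp.α) pp.δ₀ pp.α pp.NH pp.N' (pp.C (B9RWSums347DefiniteFaces.exp261 (@geo9Y d ℓ hd hL b₀ b₁ (max (max (nbrM₀Y d ℓ hd hL b₀ b₁ 2) (nbrM₀Y d ℓ hd hL b₀ b₁ ((ℓ : ℝ) + 4))) (nbrM₀Y d ℓ hd hL b₀ b₁ 3))) pp.δ₀ pp.α)) (pp.Bl 0) (pp.Bt 0) + 2 * B9Thm39ReadingCoords.coordBound39 (trBasis N) * B9Thm39ReadingCoords.basisBound39 (trBasis N) * ((ℓ : ℝ) + 1) * Real.exp (((1 - 2 * pp.α) * pp.δ₀) * (((d : ℝ) + 1) * (((ℓ : ℝ) + 1) + 1) + 2)) * ((((d + 1 : ℕ) : ℝ)) ^ 2 * (2 * (10 * ((ℓ + 1 : ℕ)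 : ℝ) * (pp.a₁ / c)) * (1 + 10 * ((ℓ + 1 : ℕ) : ℝ) * (pp.a₁ / c)) * Real.exp (4 * (10 * ((ℓ + 1 : ℕ) : ℝ) * (pp.a₁ / c)))) * ((ℓ + 1 : ℕ) : ℝ) ^ 6) * (pp.C (B9RWSums347DefiniteFaces.exp261 (@geo9Y d ℓ hd hL b₀ b₁ (max (max (nbrM₀Y d ℓ hd hL b₀ b₁ 2) (nbrM₀Y d ℓ hd hL b₀ b₁ ((ℓ : ℝ) + 4))) (nbrM₀Y d ℓ hd hL b₀ b₁ 3))) pp.δ₀ pp.α)) + B9Thm39ReadingCoords.coordBound39 (trBasis N) * B9Thm39ReadingCoords.basisBound39 (trBasis N) * (pp.C (B9RWSums347DefiniteFaces.exp261 (@geo9Y d ℓ hd hL b₀ b₁ (max (max (nbrM₀Y d ℓ hd hL b₀ b₁ 2) (nbrM₀Y d ℓ hd hL b₀ b₁ ((ℓ : ℝ) + 4))) (nbrM₀Y d ℓ hd hL b₀ b₁ 3))) pp.δ₀ pp.α)) + (pp.C (B9RWSums347DefiniteFaces.exp261 (@geo9Y d ℓ hd hL b₀ b₁ (max (max (nbrM₀Y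 d ℓ hd hL b₀ b₁ 2) (nbrM₀Y d ℓ hd hL b₀ b₁ ((ℓ : ℝ) + 4))) (nbrM₀Y d ℓ hd hL b₀ b₁ 3))) pp.δ₀ pp.α))) + (pp.C (B9RWSums347DefiniteFaces.exp261 (@geo9Y d ℓ hd hL b₀ b₁ (max (max (nbrM₀Y d ℓ hd hL b₀ b₁ 2) (nbrM₀Y d ℓ hd hL b₀ b₁ ((ℓ : ℝ) + 4))) (nbrM₀Y d ℓ hd hL b₀ b₁ 3))) pp.δ₀ pp.α)) + B9Thm39ReadingCoords.coordBound39 (trBasis N) * B9Thm39ReadingCoords.basisBound39 (trBasis N) * (pp.C (B9RWSums347DefiniteFaces.exp261 (@geo9Y d ℓ hd hL b₀ b₁ (max (max (nbrM₀Y d ℓ hd hL b₀ b₁ 2) (nbrM₀Y d ℓ hd hL b₀ b₁ ((ℓ : ℝ) + 4))) (nbrM₀Y d ℓ hd hL b₀ b₁ 3))) pp.δ₀ pp.α)))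
  let ϑFv : ℝ := 2 * (10 * (((ℓ + 1 : ℕ) : ℝ)) * (1 / (cJ + 1))) * (1 + 10 * (((ℓ + 1 : ℕ) : ℝ)) * (1 / (cJ + 1))) * Real.exp (4 * (10 * (((ℓ + 1 : ℕ) : ℝ)) * (1 / (cJ + 1)))) * (((ℓ + 1 : ℕ) : ℝ))
  let K44m : ℝ := (((ℓ + 1 : ℕ) : ℝ)) * B9RWSums344Input.inputConst44 (B9RWSums347DefiniteFaces.exp261 (@geo9Y d ℓ hd hL b₀ b₁ (max (max (nbrM₀Y d ℓ hd hL b₀ b₁ 2) (nbrM₀Y d ℓ hd hL b₀ b₁ ((ℓ : ℝ) + 4))) (nbrM₀Y d ℓ hd hL b₀ b₁ 3))) pp.δ₀ pp.α) pp.δ₀ pp.α pp.NI pp.NF (B9Thm37Whole.const37 (B9RWSums347DefiniteFaces.exp261 (@geo9Y d ℓ hd hL b₀ b₁ (max (max (nbrM₀Y d ℓ hd hL b₀ b₁ 2) (nbrM₀Y d ℓ hd hL b₀ b₁ ((ℓ : ℝ) + 4))) (nbrM₀Y d ℓ hd hL b₀ b₁ 3))) pp.δ₀ pp.α) pp.δ₀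 pp.α pp.ρ pp.B₀ pp.Nc pp.N' pp.Cℓ pp.Kc) (((ℓ + 1 : ℕ) : ℝ)) (pp.BI (1 / 2)) (pp.θI (1 / 2))
  let K45 : ℝ := (((ℓ + 1 : ℕ) : ℝ)) * B9RWSums344Input.inputConst45 (B9RWSums347DefiniteFaces.exp261 (@geo9Y d ℓ hd hL b₀ b₁ (max (max (nbrM₀Y d ℓ hd hL b₀ b₁ 2) (nbrM₀Y d ℓ hd hL b₀ b₁ ((ℓ : ℝ) + 4))) (nbrM₀Y d ℓ hd hL b₀ b₁ 3))) pp.δ₀ pp.α) pp.δ₀ pp.α pp.NI pp.NF (((ℓ + 1 : ℕ) : ℝ)) (B9RWSums343Holder.holderConst (B9RWSums347DefiniteFaces.exp261 (@geo9Y d ℓ hd hL b₀ b₁ (max (max (nbrM₀Y d ℓ hd hL b₀ b₁ 2) (nbrM₀Y d ℓ hd hL b₀ b₁ ((ℓ : ℝ) + 4))) (nbrM₀Y d ℓ hd hL b₀ b₁ 3))) pp.δ₀ pp.α) pp.δ₀ pp.α pp.NH pp.NF (B9Thm37Whole.const37 (B9RWSums347DefiniteFaces.exp261 (@geo9Y d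 ℓ hd hL b₀ b₁ (max (max (nbrM₀Y d ℓ hd hL b₀ b₁ 2) (nbrM₀Y d ℓ hd hL b₀ b₁ ((ℓ : ℝ) + 4))) (nbrM₀Y d ℓ hd hL b₀ b₁ 3))) pp.δ₀ pp.α) pp.δ₀ pp.α pp.ρ pp.B₀ pp.Nc pp.N' pp.Cℓ pp.Kc) (pp.Bl 0) (pp.Bt 0)) (pp.BI2 0 0) (pp.θI 0)
  let K44G : ℝ := (((ℓ + 1 : ℕ) : ℝ)) * ((((d + 1 : ℕ) : ℝ)) * ((1 + CLip d ℓ) * B9RWSums344Input.inputConst44 (B9RWSums347DefiniteFaces.exp261 (@geo9Y d ℓ hd hL b₀ b₁ (max (max (nbrM₀Y d ℓ hd hL b₀ b₁ 2) (nbrM₀Y d ℓ hd hL b₀ b₁ ((ℓ : ℝ) + 4))) (nbrM₀Y d ℓ hd hL b₀ b₁ 3))) pp.δ₀ pp.α) pp.δ₀ pp.α pp.NI pp.N' (pp.C (B9RWSums347DefiniteFaces.exp261 (@geo9Y d ℓ hd hL b₀ b₁ (max (max (nbrM₀Y d ℓ hd hL b₀ b₁ 2) (nbrM₀Y d ℓ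 hd hL b₀ b₁ ((ℓ : ℝ) + 4))) (nbrM₀Y d ℓ hd hL b₀ b₁ 3))) pp.δ₀ pp.α)) (((ℓ + 1 : ℕ) : ℝ)) (pp.BI (1 / 2)) (pp.θI (1 / 2)) * ((((ℓ + 1 : ℕ) : ℝ)) * ((((ℓ + 1 : ℕ) : ℝ)) ^ 3 * (2 + 2 * coordBound39 (trBasis N) * basisBound39 (trBasis N) * (((ℓ + 1 : ℕ) : ℝ)) ^ 2)) * Real.exp ((1 - pp.αF) * ((1 - 2 * pp.α) * pp.δ₀) * (2 * (rNear d ℓ + 1) + (((d : ℝ) + 1) * (((ℓ : ℝ) + 1) + 1) + 2)))) * B6.c1 (B9RWSums347DefiniteFaces.exp261 (@geo9Y d ℓ hd hL b₀ b₁ (max (max (nbrM₀Y d ℓ hd hL b₀ b₁ 2) (nbrM₀Y d ℓ hd hL b₀ b₁ ((ℓ : ℝ) + 4))) (nbrM₀Y d ℓ hd hL b₀ b₁ 3))) pp.δ₀ pp.α) pp.δ₀ pp.α))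
  let K45W : ℝ := (((d + 1 : ℕ) : ℝ)) * ((((((ℓ + 1 : ℕ) : ℝ)) * ((1 + CLip d ℓ) * B9RWSums344Input.inputConst45 (B9RWSums347DefiniteFaces.exp261 (@geo9Y d ℓ hd hL b₀ b₁ (max (max (nbrM₀Y d ℓ hd hL b₀ b₁ 2) (nbrM₀Y d ℓ hd hL b₀ b₁ ((ℓ : ℝ) + 4))) (nbrM₀Y d ℓ hd hL b₀ b₁ 3))) pp.δ₀ pp.α) pp.δ₀ pp.α pp.NI pp.N' (((ℓ + 1 : ℕ) : ℝ)) (B9RWSums343Holder.holderConst (B9RWSums347DefiniteFaces.exp261 (@geo9Y d ℓ hd hL b₀ b₁ (max (max (nbrM₀Y d ℓ hd hL b₀ b₁ 2) (nbrM₀Y d ℓ hd hL b₀ b₁ ((ℓ : ℝ) + 4))) (nbrM₀Y d ℓ hd hL b₀ b₁ 3))) pp.δ₀ pp.α) pp.δ₀ pp.α pp.NH pp.N' (pp.C (B9RWSums347DefiniteFaces.exp261 (@geo9Y d ℓ hd hL b₀ b₁ (max (max (nbrM₀Y d ℓ hd hL b₀ b₁ 2) (nbrM₀Y d ℓ hd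 hL b₀ b₁ ((ℓ : ℝ) + 4))) (nbrM₀Y d ℓ hd hL b₀ b₁ 3))) pp.δ₀ pp.α)) (pp.Bl 0) (pp.Bt 0)) (pp.BI2 0 0) (pp.θI 0) * ((((ℓ + 1 : ℕ) : ℝ)) * ((((ℓ + 1 : ℕ) : ℝ)) ^ 3 * (2 + 2 * coordBound39 (trBasis N) * basisBound39 (trBasis N) * (((ℓ + 1 : ℕ) : ℝ)) ^ 2)) * Real.exp ((1 - pp.αF) * ((1 - 2 * pp.α) * pp.δ₀) * (2 * (rNear d ℓ + 1) + (((d : ℝ) + 1) * (((ℓ : ℝ) + 1) + 1) + 2)))) * B6.c1 (B9RWSums347DefiniteFaces.exp261 (@geo9Y d ℓ hd hL b₀ b₁ (max (max (nbrM₀Y d ℓ hd hL b₀ b₁ 2) (nbrM₀Y d ℓ hd hL b₀ b₁ ((ℓ : ℝ) + 4))) (nbrM₀Y d ℓ hd hL b₀ b₁ 3))) pp.δ₀ pp.α) pp.δ₀ pp.α)) + 2 * coordBound39 (trBasis N) * basisBound39 (trBasis N) * ((ℓ : ℝ) + 1) * Real.exp (((1 - pp.αF) * ((1 - 2 * pp.α)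 * pp.δ₀) - 3 * (pp.α * pp.δ₀)) * (((d : ℝ) + 1) * (((ℓ : ℝ) + 1) + 1) + 2)) * ((((d + 1 : ℕ) : ℝ)) ^ 2 * (2 * (10 * (((ℓ + 1 : ℕ) : ℝ)) * (pp.a₁ / c)) * (1 + 10 * (((ℓ + 1 : ℕ) : ℝ)) * (pp.a₁ / c)) * Real.exp (4 * (10 * (((ℓ + 1 : ℕ) : ℝ)) * (pp.a₁ / c)))) * (((ℓ + 1 : ℕ) : ℝ)) ^ 6) * ((((ℓ + 1 : ℕ) : ℝ)) * ((1 + CLip d ℓ) * B9RWSums344Input.inputConst44 (B9RWSums347DefiniteFaces.exp261 (@geo9Y d ℓ hd hL b₀ b₁ (max (max (nbrM₀Y d ℓ hd hL b₀ b₁ 2) (nbrM₀Y d ℓ hd hL b₀ b₁ ((ℓ : ℝ) + 4))) (nbrM₀Y d ℓ hd hL b₀ b₁ 3))) pp.δ₀ pp.α) pp.δ₀ pp.α pp.NI pp.N' (pp.C (B9RWSums347DefiniteFaces.exp261 (@geo9Y d ℓ hd hL b₀ b₁ (max (max (nbrM₀Y d ℓ hd hL b₀ b₁ 2) (nbrM₀Y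 d ℓ hd hL b₀ b₁ ((ℓ : ℝ) + 4))) (nbrM₀Y d ℓ hd hL b₀ b₁ 3))) pp.δ₀ pp.α)) (((ℓ + 1 : ℕ) : ℝ)) (pp.BI 0) (pp.θI 0) * ((((ℓ + 1 : ℕ) : ℝ)) * ((((ℓ + 1 : ℕ) : ℝ)) ^ 3 * (2 + 2 * coordBound39 (trBasis N) * basisBound39 (trBasis N) * (((ℓ + 1 : ℕ) : ℝ)) ^ 2)) * Real.exp ((1 - pp.αF) * ((1 - 2 * pp.α) * pp.δ₀) * (2 * (rNear d ℓ + 1) + (((d : ℝ) + 1) * (((ℓ : ℝ) + 1) + 1) + 2)))) * B6.c1 (B9RWSums347DefiniteFaces.exp261 (@geo9Y d ℓ hd hL b₀ b₁ (max (max (nbrM₀Y d ℓ hd hL b₀ b₁ 2) (nbrM₀Y d ℓ hd hL b₀ b₁ ((ℓ : ℝ) + 4))) (nbrM₀Y d ℓ hd hL b₀ b₁ 3))) pp.δ₀ pp.α) pp.δ₀ pp.α)) + coordBound39 (trBasis N) * basisBound39 (trBasis N) * ((((ℓ + 1 : ℕ) : ℝ)) * ((1 + CLip d ℓ) * B9RWSums344Input.inputConst44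 (B9RWSums347DefiniteFaces.exp261 (@geo9Y d ℓ hd hL b₀ b₁ (max (max (nbrM₀Y d ℓ hd hL b₀ b₁ 2) (nbrM₀Y d ℓ hd hL b₀ b₁ ((ℓ : ℝ) + 4))) (nbrM₀Y d ℓ hd hL b₀ b₁ 3))) pp.δ₀ pp.α) pp.δ₀ pp.α pp.NI pp.N' (pp.C (B9RWSums347DefiniteFaces.exp261 (@geo9Y d ℓ hd hL b₀ b₁ (max (max (nbrM₀Y d ℓ hd hL b₀ b₁ 2) (nbrM₀Y d ℓ hd hL b₀ b₁ ((ℓ : ℝ) + 4))) (nbrM₀Y d ℓ hd hL b₀ b₁ 3))) pp.δ₀ pp.α)) (((ℓ + 1 : ℕ) : ℝ)) (pp.BI 0) (pp.θI 0) * ((((ℓ + 1 : ℕ) : ℝ)) * ((((ℓ + 1 : ℕ) : ℝ)) ^ 3 * (2 + 2 * coordBound39 (trBasis N) * basisBound39 (trBasis N) * (((ℓ + 1 : ℕ) : ℝ)) ^ 2)) * Real.exp ((1 - pp.αF) * ((1 - 2 * pp.α) * pp.δ₀) * (2 * (rNear d ℓ + 1) + (((d : ℝ) + 1) * (((ℓ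 : ℝ) + 1) + 1) + 2)))) * B6.c1 (B9RWSums347DefiniteFaces.exp261 (@geo9Y d ℓ hd hL b₀ b₁ (max (max (nbrM₀Y d ℓ hd hL b₀ b₁ 2) (nbrM₀Y d ℓ hd hL b₀ b₁ ((ℓ : ℝ) + 4))) (nbrM₀Y d ℓ hd hL b₀ b₁ 3))) pp.δ₀ pp.α) pp.δ₀ pp.α)) + ((((ℓ + 1 : ℕ) : ℝ)) * ((1 + CLip d ℓ) * B9RWSums344Input.inputConst44 (B9RWSums347DefiniteFaces.exp261 (@geo9Y d ℓ hd hL b₀ b₁ (max (max (nbrM₀Y d ℓ hd hL b₀ b₁ 2) (nbrM₀Y d ℓ hd hL b₀ b₁ ((ℓ : ℝ) + 4))) (nbrM₀Y d ℓ hd hL b₀ b₁ 3))) pp.δ₀ pp.α) pp.δ₀ pp.α pp.NI pp.N' (pp.C (B9RWSums347DefiniteFaces.exp261 (@geo9Y d ℓ hd hL b₀ b₁ (max (max (nbrM₀Y d ℓ hd hL b₀ b₁ 2) (nbrM₀Y d ℓ hd hL b₀ b₁ ((ℓ : ℝ) + 4))) (nbrM₀Y d ℓ hd hL b₀ b₁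 3))) pp.δ₀ pp.α)) (((ℓ + 1 : ℕ) : ℝ)) (pp.BI 0) (pp.θI 0) * ((((ℓ + 1 : ℕ) : ℝ)) * ((((ℓ + 1 : ℕ) : ℝ)) ^ 3 * (2 + 2 * coordBound39 (trBasis N) * basisBound39 (trBasis N) * (((ℓ + 1 : ℕ) : ℝ)) ^ 2)) * Real.exp ((1 - pp.αF) * ((1 - 2 * pp.α) * pp.δ₀) * (2 * (rNear d ℓ + 1) + (((d : ℝ) + 1) * (((ℓ : ℝ) + 1) + 1) + 2)))) * B6.c1 (B9RWSums347DefiniteFaces.exp261 (@geo9Y d ℓ hd hL b₀ b₁ (max (max (nbrM₀Y d ℓ hd hL b₀ b₁ 2) (nbrM₀Y d ℓ hd hL b₀ b₁ ((ℓ : ℝ) + 4))) (nbrM₀Y d ℓ hd hL b₀ b₁ 3))) pp.δ₀ pp.α) pp.δ₀ pp.α))) + ((((ℓ + 1 : ℕ) : ℝ)) * ((1 + CLip d ℓ) * B9RWSums344Input.inputConst44 (B9RWSums347DefiniteFaces.exp261 (@geo9Y d ℓ hd hL b₀ b₁ (max (max (nbrM₀Y d ℓ hd hL b₀ b₁ 2)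 (nbrM₀Y d ℓ hd hL b₀ b₁ ((ℓ : ℝ) + 4))) (nbrM₀Y d ℓ hd hL b₀ b₁ 3))) pp.δ₀ pp.α) pp.δ₀ pp.α pp.NI pp.N' (pp.C (B9RWSums347DefiniteFaces.exp261 (@geo9Y d ℓ hd hL b₀ b₁ (max (max (nbrM₀Y d ℓ hd hL b₀ b₁ 2) (nbrM₀Y d ℓ hd hL b₀ b₁ ((ℓ : ℝ) + 4))) (nbrM₀Y d ℓ hd hL b₀ b₁ 3))) pp.δ₀ pp.α)) (((ℓ + 1 : ℕ) : ℝ)) (pp.BI 0) (pp.θI 0) * ((((ℓ + 1 : ℕ) : ℝ)) * ((((ℓ + 1 : ℕ) : ℝ)) ^ 3 * (2 + 2 * coordBound39 (trBasis N) * basisBound39 (trBasis N) * (((ℓ + 1 : ℕ) : ℝ)) ^ 2)) * Real.exp ((1 - pp.αF) * ((1 - 2 * pp.α) * pp.δ₀) * (2 * (rNear d ℓ + 1) + (((d : ℝ) + 1) * (((ℓ : ℝ) + 1) + 1) + 2)))) * B6.c1 (B9RWSums347DefiniteFaces.exp261 (@geo9Y d ℓ hd hL b₀ b₁ (max (max (nbrM₀Y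 d ℓ hd hL b₀ b₁ 2) (nbrM₀Y d ℓ hd hL b₀ b₁ ((ℓ : ℝ) + 4))) (nbrM₀Y d ℓ hd hL b₀ b₁ 3))) pp.δ₀ pp.α) pp.δ₀ pp.α)) + coordBound39 (trBasis N) * basisBound39 (trBasis N) * ((((ℓ + 1 : ℕ) : ℝ)) * ((1 + CLip d ℓ) * B9RWSums344Input.inputConst44 (B9RWSums347DefiniteFaces.exp261 (@geo9Y d ℓ hd hL b₀ b₁ (max (max (nbrM₀Y d ℓ hd hL b₀ b₁ 2) (nbrM₀Y d ℓ hd hL b₀ b₁ ((ℓ : ℝ) + 4))) (nbrM₀Y d ℓ hd hL b₀ b₁ 3))) pp.δ₀ pp.α) pp.δ₀ pp.α pp.NI pp.N' (pp.C (B9RWSums347DefiniteFaces.exp261 (@geo9Y d ℓ hd hL b₀ b₁ (max (max (nbrM₀Y d ℓ hd hL b₀ b₁ 2) (nbrM₀Y d ℓ hd hL b₀ b₁ ((ℓ : ℝ) + 4))) (nbrM₀Y d ℓ hd hL b₀ b₁ 3))) pp.δ₀ pp.α)) (((ℓ + 1 : ℕ) : ℝ)) (pp.BI 0) (pp.θI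 0) * ((((ℓ + 1 : ℕ) : ℝ)) * ((((ℓ + 1 : ℕ) : ℝ)) ^ 3 * (2 + 2 * coordBound39 (trBasis N) * basisBound39 (trBasis N) * (((ℓ + 1 : ℕ) : ℝ)) ^ 2)) * Real.exp ((1 - pp.αF) * ((1 - 2 * pp.α) * pp.δ₀) * (2 * (rNear d ℓ + 1) + (((d : ℝ) + 1) * (((ℓ : ℝ) + 1) + 1) + 2)))) * B6.c1 (B9RWSums347DefiniteFaces.exp261 (@geo9Y d ℓ hd hL b₀ b₁ (max (max (nbrM₀Y d ℓ hd hL b₀ b₁ 2) (nbrM₀Y d ℓ hd hL b₀ b₁ ((ℓ : ℝ) + 4))) (nbrM₀Y d ℓ hd hL b₀ b₁ 3))) pp.δ₀ pp.α) pp.δ₀ pp.α)))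
  let X107 : ℝ := (cR39 (trBasis N))⁻¹ * (((1 / 2 : ℝ))⁻¹ * max 0 K45W + max 0 KW * (CPw * (((ℓ + 1 : ℕ) : ℝ))) * (((1 / 2 : ℝ))⁻¹ * ((((ℓ + 1 : ℕ) : ℝ)) * Real.exp ((s / 16 - 1 / 1000 * (s / 16) - s / 4000) * (rNear d ℓ + 1)))) * rowConst261 (@geo9Y d ℓ hd hL b₀ b₁ (max (max (nbrM₀Y d ℓ hd hL b₀ b₁ 2) (nbrM₀Y d ℓ hd hL b₀ b₁ ((ℓ : ℝ) + 4))) (nbrM₀Y d ℓ hd hL b₀ b₁ 3))) (s / 4000) * rowConst261 (@geo9Y d ℓ hd hL b₀ b₁ (max (max (nbrM₀Y d ℓ hd hL b₀ b₁ 2) (nbrM₀Y d ℓ hd hL b₀ b₁ ((ℓ : ℝ) + 4))) (nbrM₀Y d ℓ hd hL b₀ b₁ 3))) (s / 4000))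
  refine ⟨1 / 2, s, s, 1, 1, 1, 1, 1, pp, pp, ⟨0, 0, 0⟩, ⟨0, 0, 0⟩, ⟨W, BMx, θW ((((ℓ + 1 : ℕ) : ℝ)) ^ 2) * Real.exp ((3 / 4 + s) * 3) * BRc⟩, ⟨0, 0, 0⟩, 9 * s / 20, s / 50, s / 1000, s / 100, 1 / (cJ + 1), 1,
    max (max (max ((cR39 (trBasis N))⁻¹ * (((1 / 2 : ℝ))⁻¹ * max 0 K44G + (((d + 1 : ℕ) : ℝ) * pp.C (B9RWSums347DefiniteFaces.exp261 (@geo9Y d ℓ hd hL b₀ b₁ (max (max (nbrM₀Y d ℓ hd hL b₀ b₁ 2) (nbrM₀Y d ℓ hd hL b₀ b₁ ((ℓ : ℝ) + 4))) (nbrM₀Y d ℓ hd hL b₀ b₁ 3))) pp.δ₀ pp.α)) * (CPw * (((ℓ + 1 : ℕ) : ℝ))) * (((1 / 2 : ℝ))⁻¹ * ((((ℓ + 1 : ℕ) : ℝ)) * Real.exp ((s / 16 - 1 / 1000 * (s / 16) - s / 4000) * (rNear d ℓ + 1)))) * rowConst261 (@geo9Y d ℓ hd hL b₀ b₁ (max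 (max (nbrM₀Y d ℓ hd hL b₀ b₁ 2) (nbrM₀Y d ℓ hd hL b₀ b₁ ((ℓ : ℝ) + 4))) (nbrM₀Y d ℓ hd hL b₀ b₁ 3))) (s / 4000) * rowConst261 (@geo9Y d ℓ hd hL b₀ b₁ (max (max (nbrM₀Y d ℓ hd hL b₀ b₁ 2) (nbrM₀Y d ℓ hd hL b₀ b₁ ((ℓ : ℝ) + 4))) (nbrM₀Y d ℓ hd hL b₀ b₁ 3))) (s / 4000))) (K43 * (cR39 (trBasis N))⁻¹ * rowConst261 (@geo9Y d ℓ hd hL b₀ b₁ (max (max (nbrM₀Y d ℓ hd hL b₀ b₁ 2) (nbrM₀Y d ℓ hd hL b₀ b₁ ((ℓ : ℝ) + 4))) (nbrM₀Y d ℓ hd hL b₀ b₁ 3))) (s / 4000) + CTel d ℓ (trBasis N) (s / 20) (CPw * (((ℓ + 1 : ℕ) : ℝ)) * ((((d + 1 : ℕ) : ℝ) * pp.C (B9RWSums347DefiniteFaces.exp261 (@geo9Y d ℓ hd hL b₀ b₁ (max (max (nbrM₀Y d ℓ hd hL b₀ b₁ 2) (nbrM₀Y d ℓ hd hL b₀ b₁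 ((ℓ : ℝ) + 4))) (nbrM₀Y d ℓ hd hL b₀ b₁ 3))) pp.δ₀ pp.α)) * (cR39 (trBasis N))⁻¹ * rowConst261 (@geo9Y d ℓ hd hL b₀ b₁ (max (max (nbrM₀Y d ℓ hd hL b₀ b₁ 2) (nbrM₀Y d ℓ hd hL b₀ b₁ ((ℓ : ℝ) + 4))) (nbrM₀Y d ℓ hd hL b₀ b₁ 3))) (s / 4000)) * rowConst261 (@geo9Y d ℓ hd hL b₀ b₁ (max (max (nbrM₀Y d ℓ hd hL b₀ b₁ 2) (nbrM₀Y d ℓ hd hL b₀ b₁ ((ℓ : ℝ) + 4))) (nbrM₀Y d ℓ hd hL b₀ b₁ 3))) (s / 4000)) (CPw * (((ℓ + 1 : ℕ) : ℝ)) * ((((d + 1 : ℕ) : ℝ) * pp.C (B9RWSums347DefiniteFaces.exp261 (@geo9Y d ℓ hd hL b₀ b₁ (max (max (nbrM₀Y d ℓ hd hL b₀ b₁ 2) (nbrM₀Y d ℓ hd hL b₀ b₁ ((ℓ : ℝ) + 4))) (nbrM₀Y d ℓ hd hL b₀ b₁ 3))) pp.δ₀ pp.α)) * (cR39 (trBasis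 N))⁻¹ * rowConst261 (@geo9Y d ℓ hd hL b₀ b₁ (max (max (nbrM₀Y d ℓ hd hL b₀ b₁ 2) (nbrM₀Y d ℓ hd hL b₀ b₁ ((ℓ : ℝ) + 4))) (nbrM₀Y d ℓ hd hL b₀ b₁ 3))) (s / 4000)) * rowConst261 (@geo9Y d ℓ hd hL b₀ b₁ (max (max (nbrM₀Y d ℓ hd hL b₀ b₁ 2) (nbrM₀Y d ℓ hd hL b₀ b₁ ((ℓ : ℝ) + 4))) (nbrM₀Y d ℓ hd hL b₀ b₁ 3))) (s / 4000)))) (max (((d : ℝ) + 1) * ((1 + CLip d ℓ) * max 0 K44m * (CJG d ℓ (trBasis N) (1 / 2) (thetaL d ℓ ϑFv) (1 / 2) (s / 20 + 1 + 1 / 2 * (s / 10 - s / 20)) * (((ℓ + 1 : ℕ) : ℝ))) * rowConst261 (@geo9Y d ℓ hd hL b₀ b₁ (max (max (nbrM₀Y d ℓ hd hL b₀ b₁ 2) (nbrM₀Y d ℓ hd hL b₀ b₁ ((ℓ : ℝ) + 4))) (nbrM₀Y d ℓ hd hL b₀ b₁ 3))) 1)) (((d : ℝ) + 1) * (1 *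 (((d : ℝ) + 1) * ((1 + CLip d ℓ) * max 0 K44m * (CJG d ℓ (trBasis N) (1 / 2) (thetaL d ℓ ϑFv) (1 / 2) (s / 20 + 1 + 1 / 2 * (s / 10 - s / 20)) * (((ℓ + 1 : ℕ) : ℝ))) * rowConst261 (@geo9Y d ℓ hd hL b₀ b₁ (max (max (nbrM₀Y d ℓ hd hL b₀ b₁ 2) (nbrM₀Y d ℓ hd hL b₀ b₁ ((ℓ : ℝ) + 4))) (nbrM₀Y d ℓ hd hL b₀ b₁ 3))) 1)) * rowConst261 (@geo9Y d ℓ hd hL b₀ b₁ (max (max (nbrM₀Y d ℓ hd hL b₀ b₁ 2) (nbrM₀Y d ℓ hd hL b₀ b₁ ((ℓ : ℝ) + 4))) (nbrM₀Y d ℓ hd hL b₀ b₁ 3))) 1)))) 0,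
    s / 20, s / 200, 1 / 8, 0, s / 1000, fun _ => 0, 0, s / 20, s / 25, s / 1000, 0, fun _ => 0, fun _ => 0, fun _ => max 0 X107, fun _ => 0, fun _ _ => 0, 2 * ((d : ℝ) + 1) * (((ℓ + 1 : ℕ) : ℝ)) ^ 3 * (N : ℝ) * (10 ^ 4 * ((d : ℝ) + 1) * cJ) * Real.exp (3 * s), s, s / 16, s / 16, fun _ => 0, fun _ => 0, 1, 1, 1, fun _ => 1 / 2, fun _ => 1 / 2, fun β => (1 + β) / 2, fun _ => max 0 K45, ϑFv, s / 10, s / 10, fun _ => max 0 K45, 1 / 1000, s / 4000, s / 16, s / 16, fun _ => max 0 K45W, s / 16, fun _ => max 0 KW, CPw, 1 / 2, s / 10, max 0 K44m, max 0 K44G, s / 16, 0, s / 20 + s / 4000, 0, s / 20, s / 20, 0, fun _ => 0, K43, s / 2, s / 20, s / 4000, s / 40, max 0 ((1 / 2 : ℝ) * max 0 X107), 1, 2 * ((d : ℝ) + 1) + (rLB d ℓ + 1) + 1, 1, 1, B0D, by norm_num, by norm_num, hs, le_rfl, by norm_num, by norm_num, by norm_num, by norm_num, by norm_num, hpp, hpp,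 ⟨le_rfl, le_rfl, le_rfl⟩, ⟨le_rfl, le_rfl, le_rfl⟩, ⟨hW, hBMx.le, by have := hθW ((((ℓ + 1 : ℕ) : ℝ)) ^ 2) (by positivity); positivity⟩, ⟨le_rfl, le_rfl, le_rfl⟩, (le_max_left _ _).trans (le_max_left _ _), (le_max_right _ _).trans (le_max_left _ _), le_max_right _ _, le_rfl, by positivity, by linarith, by linarith, fun _ => le_rfl, le_max_right _ _, by positivity, by positivity, by linarith, by linarith, by linarith, by positivity, by norm_num, by norm_num, by norm_num, by linarith, ?_, le_rfl, by positivity, by linarith, by linarith, ?_, le_rfl, div_le_one_of_le₀ (by linarith) (by positivity), by linarith, by positivity, by linarith, by linarith, le_rfl, fun _ _ => le_rfl, fun _ _ _ => le_rfl, fun _ _ _ => le_max_left _ _, fun _ _ _ => le_rfl, fun _ _ _ _ _ _ => le_rfl, hcJ, (by rw [mul_one_div]; exact div_le_one_of_le₀ (by linarith) (by positivity)), le_rfl, ?_, by linarith, by positivity, ?_, fun _ _ _ => le_rfl, fun _ _ _ => le_rfl, by norm_num, by norm_num, by norm_num, by linarith, le_rfl, ?_, (le_max_left _ _).trans (le_max_right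 _ _), (min_le_right _ _).trans (min_le_left _ _), le_rfl, hsM, (le_max_right _ _).trans (le_max_right _ _), (min_le_right _ _).trans (min_le_right _ _), hsR, le_rfl, le_rfl, le_rfl, le_rfl, le_rfl, le_rfl, le_rfl, le_rfl, fun _ => by norm_num, fun _ => by norm_num, fun _ => by norm_num, fun _ => by norm_num, fun _ h0 _ => by linarith, fun _ _ h1 => by linarith, fun _ _ _ => by norm_num, le_rfl, by linarith, fun _ _ _ => le_max_left _ _, by linarith, fun _ _ _ => le_max_left _ _, by norm_num, by norm_num, by positivity, by positivity, ?_, by nlinarith, by nlinarith, fun _ _ _ => by norm_num, by nlinarith, fun _ _ _ => le_max_left _ _, by nlinarith, fun _ _ _ => le_max_left _ _, le_rfl, fun _ _ _ => le_max_right _ _, by norm_num, by norm_num, by norm_num, by linarith, le_max_left _ _, ((le_max_left _ _).trans (le_max_right _ _)).trans (le_max_left _ _),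
    ((le_max_right _ _).trans (le_max_right _ _)).trans (le_max_left _ _), by norm_num, le_max_left _ _, by linarith, ((le_max_left _ _).trans (le_max_left _ _)).trans (le_max_left _ _), le_rfl, fun _ _ _ => le_rfl, le_rfl, le_rfl, by positivity, le_rfl, le_rfl, by simp, fun s _ _ => by rw [show pp.NH = (0 : ℝ) from rfl, show pp.NF = (0 : ℝ) from rfl]; simp [B9RWSums343Holder.holderConst], by simp, le_rfl, by
      have h1 := PinPrims.C_nonneg hpp (B9RWSums347DefiniteFaces.exp261 (@geo9Y d ℓ hd hL b₀ b₁ (max (max (nbrM₀Y d ℓ hd hL b₀ b₁ 2) (nbrM₀Y d ℓ hd hL b₀ b₁ ((ℓ : ℝ) + 4))) (nbrM₀Y d ℓ hd hL b₀ b₁ 3))) pp.δ₀ pp.α)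
      have h2 : (0 : ℝ) ≤ B0D := le_max_left _ _
      positivity, by positivity, by nlinarith, by linarith, le_rfl, ((le_max_right _ _).trans (le_max_left _ _)).trans (le_max_left _ _), by positivity, le_max_left _ _, fun _ _ _ => le_max_right _ _, by linarith, ?_, ?_, by linarith, by linarith, by linarith, by linarith, by linarith, by linarith, by linarith, by linarith, by linarith, by linarith, zero_le_one, ?_, by norm_num, by norm_num, ?_, ?_, le_max_left _ _, fun _ _ _ => le_max_right _ _, le_rfl, by rw [hα, hδ]; linarith, fun _ _ _ => le_max_right _ _, by rw [hα, hδ]; linarith, by rw [hα, hF]; norm_num, fun _ _ h1 => by linarith, le_max_right _ _, by rw [hα, hF, hδ]; nlinarith [hs], fun _ _ _ => le_max_right _ _, by rw [hα, hF, hδ]; nlinarith [hs], fun _ _ _ => le_max_right _ _, by rw [hα, hF, hδ]; nlinarith [hs], le_max_right _ _, by rw [hα, hF, hδ]; nlinarith [hs], fun _ _ _ => le_max_right _ _, by rw [hα, hF, hδ]; nlinarith [hs]⟩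
  · rw [hF, hα, hδ]; linarith
  · rw [hF, hα, hδ]; linarith
  · rw [hα, hδ, min_eq_left (by linarith)]; linarith
  · rw [hF, hα, hδ]; linarith
  · rw [hF]; linarith
  · rw [hα, hδ, min_eq_left (by linarith)]; linarith
  · rw [hα, hδ]; linarith
  · rw [hα, hδ, min_eq_left (by linarith)]; linarith
  · have h := rLB_nonneg d ℓ; have hd0 : (0 : ℝ) ≤ d := Nat.cast_nonneg d; linarith
  · have h := rLB_nonneg d ℓ; linarith
  · have hd0 : (0 : ℝ) ≤ d := Nat.cast_nonneg d; linarith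

end Summit.QuantumFields.YangMills.BalabanUVNodes.N06NumericsWitnessO

end
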